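import Literature.AlgebraicGeometry.ModuliOfAbelianVarieties.SiegelFamilyRealPointsLevelTwo
import HarnessLib

/-!
# Goresky–Tai's Proposition 10: at a period point fixed only by `±I`, a `Γ(2)`-element `γ` with `γZ = Z̃`
# is a COBOUNDARY `γ = τ(h)h⁻¹`, `h ∈ Sp_{2g}(ℤ)` — «in this case `X` is integral»: `Z ∈ Sp_{2g}(ℤ) · iC_g`,
# and `𝔥_g^γ = h · iC_g`
# (Goresky–Tai 2003, §4 Prop. 10, §7.2, §3 Lemma 3 and Prop. 6)

Topic `Literature/AlgebraicGeometry/ModuliOfAbelianVarieties` (the Siegel-family files, namespace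
`Literature.AlgebraicGeometry.ModuliOfAbelianVarieties.SiegelModuli`).  Lane `lit-hodgefound` (Track 2
foundations library), prover seat p15 generation 51, row g51-#5, on top of g51-#4
`SiegelFamilyRealPointsLevelTwo` (Lemma 9; at level `2` the sign `τ(γ)γ` is `+1`), g51-#2
`SiegelFamilyRealPointsComessattiLemma` (`T_N = (1 −N; 0 1)`, cocycle ⟺ `Z ∈ Γ_g · H'_g`, transport along
`Γ_g`-orbits, coboundaries have real points) and g50-#7 `SiegelFamilyRealModuliPoints` (`τ(x • Ω) = τ(x) • τΩ`,
`τΩ = Ω ⟺ Re Ω = 0`, `I_* J I_* = −J`).  THEOREMS ONLY: no definition, no instance, no notation, no named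
fact (net Literature debt `0`), no `sorry`.

## Source, VERBATIM

M. Goresky, Y. S. Tai, *The moduli space of real abelian varieties with level structure*, Compositio
Math. **139** (2003) = arXiv:math/0108103, held `paper:arxiv-math_0108103`.  §4 p0008: «**Proposition 10.**
Let `γ ∈ Γ(2)` and suppose that `Z ∈ 𝔥_n` is not fixed by any element of `Sp(2n, ℤ)` other than `±I`.
Suppose that `Z̃ = γZ`.  Then there exists `h ∈ Sp(2n, ℤ)` such that `γ = h̃h⁻¹`, hence `𝔥_n^γ = h · iC_n`.»
§7.2 p0012 (its proof): «By Comessatti's lemma, `Z` is equivalent (via some `h ∈ Sp(2n, ℤ)`) to some element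
`X + iY ∈ 𝔥_n` with `2X ∈ M_{n×n}(ℤ)`.  We claim, in this case, that `X` is integral.  Translation by `X` is
given by the symplectic matrix `T_X = (I X; 0 I)` so we may write `Z = h(X + iY) = hT_X iY`.  Then
`τZ = τ(hT_X)iY = γZ`, so the following element `γ⁻¹τ(hT_X)(hT_X)⁻¹` fixes `Z`.  By our assumption on `Z`,
this implies that `γ = ±I τ(hT_X)(hT_X)⁻¹` or, `±T_{−2X} = h̃⁻¹γh = (h̃⁻¹h)(h⁻¹γh) ∈ Γ(2).Γ(4m)` (using
Lemma 9 and the fact that `Γ(4m)` is normal in `Sp(2n, ℤ)`).  So `2X` is "even", hence `X` is integral.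
If the plus sign occurs in (7.3) then `γ = τ(hT_X)(hT_X)⁻¹` hence `𝔥_n^γ = hT_X · iC_n`.  If the minus
sign occurs, set `ω = (0 −I; I 0)`.  Then `γ = τ(hT_Xω)(hT_Xω)⁻¹` and hence `𝔥_n^γ = hT_Xω · iC_n`.»
§3.1 p0005: «`f_γ` is a coboundary iff there exists `h ∈ Sp(2n, ℝ)` so that `γ = h̃h⁻¹`»; §3.3 «Suppose
`f_γ` is a coboundary, say `γ = h̃h⁻¹`.  Then `γhiY = τ(hiY)` for any `Y ∈ C_n`»; Prop. 6: «In this case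
`𝔥_n^γ = giC_n`».

## What is proved (`Γ_g = siegelModularGroup g = ι(Sp_{2g}(ℤ))`, `τ(x) = I_* x I_*`, `τΩ = −Ω̄`;
## `Γ_g(2) = siegelPrincipalGamma g 2`; «not fixed by any element other than `±I`» = the hypothesis `hstab`)

* §1 `smul_eq_negConj_iff_of_coboundary` (**`𝔥_g^{τ(h)h⁻¹} = h · iC_g`**: `(τ(h)h⁻¹) • Ω = τΩ ⟺
  Re(h⁻¹ • Ω) = 0`, every `h ∈ Sp_{2g}(ℝ)`), `J_mem_siegelModularGroup` (`ω ∈ Γ_g`),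
  `coe_iStarConj_mul_J_mul_inv` (`τ(hω)(hω)⁻¹ = −τ(h)h⁻¹`: «If the minus sign occurs, set `ω = (0 −I; I 0)`»),
  `symplecticIntHom_conjK` (`ι(KηK) = τ(ι η)`), `coe_eq_or_eq_neg_of_smul_eq_negConj_of_stab` («By our
  assumption on `Z`, this implies that `γ = ±…`»).
* §2 **`two_dvd_of_two_mul_re_smul_eq_of_mem_siegelPrincipalGamma_two`** — the heart of §7.2: if `Stab_{Γ_g}(Z) ⊆ ±1`,
  `γ ∈ Γ_g(2)`, `γ • Z = τZ`, and `2 Re(y • Z) = N ∈ M_g(ℤ)` for some `y ∈ Γ_g`, then `N` is EVEN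
  (`±T_N = (η̃η⁻¹)(ηγη⁻¹) ∈ ±Γ(2)`, Lemma 9 (1) and normality of `Γ(2)`);
  **`exists_smul_map_re_eq_zero_of_mem_siegelPrincipalGamma_two`** («`X` is integral»: `Z` is
  `Γ_g`-equivalent to a purely imaginary point `iY`, i.e. `Z ∈ Γ_g · iC_g`).
* §3 **`exists_coboundary_of_mem_siegelPrincipalGamma_two`** — PROPOSITION 10: `γ = τ(h)h⁻¹` for some
  `h ∈ Γ_g`, and `𝔥_g^γ = h · iC_g` (`∀ Ω, γ • Ω = τΩ ⟺ Re(h⁻¹ • Ω) = 0`); `…_of_end_eq_smul_one` and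
  `…_of_hodgeGeneral` versions (the isotropy hypothesis from `End(X_Z) = ℤ`, g51-#3, resp. `Z ∉ 𝒩_Hg`).

## References

* [GoreskyTai2003RealModuli] M. Goresky, Y. S. Tai, Compositio Math. 139 (2003) 1–27, §3.1, §3.3 Lemma 3,
  Prop. 6, §4 Lemma 9, Prop. 10, §7.2.
* [Shimura1972FieldOfRationality] G. Shimura, Nagoya Math. J. 45 (1972) 167–178, §3 Prop. 12 (the isotropy
  hypothesis «no automorphisms other than `±1`»).
* [AndrianovZhuravlev2015] A. N. Andrianov, V. G. Zhuravlev, Ch. 2 §2.1 (2.1) (`Γⁿ(q)`).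
* [Lange2023AbelianVarietiesComplex] H. Lange (2023), §3.1.2 Cor. 3.1.5, §7.3.1 Prop. 7.3.2.
-/

noncomputable section

open scoped Manifold Matrix ComplexConjugate
open Matrix Function

namespace Literature.AlgebraicGeometry.ModuliOfAbelianVarieties

namespace SiegelModuli

open Literature.NumberTheory.Automorphic (siegelUpperHalfSpace)
open Literature.NumberTheory.ModularForms.SiegelUpperHalfSpace (symplecticIntHom siegelModularGroup
  symplecticIntHom_injective)
open Literature.NumberTheory.ModularForms.SiegelModularForm (siegelPrincipalGamma normal_siegelPrincipalGamma
  siegelPrincipalGamma_one)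
open Literature.Geometry.Kaehler Literature.Geometry.Kaehler.ComplexTorus

variable {g : ℕ}

/-! ## §0 Casting -/

/-- The real extension of `K = (−1 0; 0 1)` is `I_*`. [folklore] -/
private theorem conjK_map_castRingHom_g51e :
    (Matrix.fromBlocks (-1 : Matrix (Fin g) (Fin g) ℤ) 0 0 (1 : Matrix (Fin g) (Fin g) ℤ)).map (Int.castRingHom ℝ) =
      Matrix.fromBlocks (-1 : Matrix (Fin g) (Fin g) ℝ) 0 0 (1 : Matrix (Fin g) (Fin g) ℝ) := by
  ext (i | i) (j | j) <;> simp [Matrix.one_apply]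

/-- The real extension of the integral `J = (0 −1; 1 0)` is the real `J`. [folklore] -/
private theorem J_map_castRingHom_g51e :
    (Matrix.J (Fin g) ℤ).map (Int.castRingHom ℝ) = Matrix.J (Fin g) ℝ := by
  ext (i | i) (j | j) <;> simp [Matrix.J, Matrix.one_apply]

/-! ## §1 Coboundaries `τ(h)h⁻¹`: their real points `h · iC_g`, the sign flip by `ω = J`, `±`-rigidity -/

/-- **`𝔥_g^{τ(h)h⁻¹} = h · iC_g`**: for every `h ∈ Sp_{2g}(ℝ)` and `Ω ∈ 𝔥_g`, `(τ(h)h⁻¹) • Ω = τΩ` iff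
`h⁻¹ • Ω` is purely imaginary («Then `γhiY = τ(hiY)` for any `Y ∈ C_n`»; «In this case `𝔥_n^γ = giC_n`»).
[cite: GoreskyTai2003RealModuli, §3.3 proof of Lemma 3 and Prop. 6] -/
theorem smul_eq_negConj_iff_of_coboundary (h : Matrix.symplecticGroup (Fin g) ℝ) (Ω : siegelUpperHalfSpace g) :
    ((⟨Matrix.fromBlocks (-1 : Matrix (Fin g) (Fin g) ℝ) 0 0 (1 : Matrix (Fin g) (Fin g) ℝ) *
            (h : Matrix (Fin g ⊕ Fin g) (Fin g ⊕ Fin g) ℝ) *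
            Matrix.fromBlocks (-1 : Matrix (Fin g) (Fin g) ℝ) 0 0 (1 : Matrix (Fin g) (Fin g) ℝ),
          iStar_mul_mul_iStar_mem_symplecticGroup h.2⟩ : Matrix.symplecticGroup (Fin g) ℝ) * h⁻¹) • Ω =
        ⟨-(Ω : Matrix (Fin g) (Fin g) ℂ).map conj, neg_map_conj_mem_siegelUpperHalfSpace Ω.2⟩ ↔
      ((h⁻¹ • Ω : siegelUpperHalfSpace g) : Matrix (Fin g) (Fin g) ℂ).map Complex.re = 0 := by
  rw [mul_smul, ← neg_map_conj_eq_self_iff]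
  constructor
  · intro hc
    have e : h⁻¹ • Ω = (⟨Matrix.fromBlocks (-1 : Matrix (Fin g) (Fin g) ℝ) 0 0 (1 : Matrix (Fin g) (Fin g) ℝ) *
          ((h⁻¹ : Matrix.symplecticGroup (Fin g) ℝ) : Matrix (Fin g ⊕ Fin g) (Fin g ⊕ Fin g) ℝ) *
          Matrix.fromBlocks (-1 : Matrix (Fin g) (Fin g) ℝ) 0 0 (1 : Matrix (Fin g) (Fin g) ℝ),
        iStar_mul_mul_iStar_mem_symplecticGroup (h⁻¹).2⟩ : Matrix.symplecticGroup (Fin g) ℝ) •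
        (⟨-(Ω : Matrix (Fin g) (Fin g) ℂ).map conj, neg_map_conj_mem_siegelUpperHalfSpace Ω.2⟩ :
          siegelUpperHalfSpace g) := by
      rw [iStarConj_inv, eq_inv_smul_iff, hc]
    rw [iStar_smul_negConj] at e
    exact (congrArg Subtype.val e).symm
  · intro hre
    have e : (⟨-((h⁻¹ • Ω : siegelUpperHalfSpace g) : Matrix (Fin g) (Fin g) ℂ).map conj,
        neg_map_conj_mem_siegelUpperHalfSpace (h⁻¹ • Ω).2⟩ : siegelUpperHalfSpace g) = h⁻¹ • Ω :=
      Subtype.ext hre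
    rw [← e, iStar_smul_negConj h (h⁻¹ • Ω)]
    simp only [smul_inv_smul]

/-- `ω = J = (0 −1; 1 0) ∈ Γ_g` (the image of the integral `J`). [cite: GoreskyTai2003RealModuli, §7.2 («set `ω = (0 −I; I 0)`»)] -/
theorem J_mem_siegelModularGroup :
    (SymplecticGroup.symJ (Fin g) ℝ : Matrix.symplecticGroup (Fin g) ℝ) ∈
      siegelModularGroup g :=
  ⟨SymplecticGroup.symJ (Fin g) ℤ, Subtype.ext (by
    change (Matrix.J (Fin g) ℤ).map (Int.castRingHom ℝ) = Matrix.J (Fin g) ℝ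
    exact J_map_castRingHom_g51e)⟩

/-- `τ(ω) = −ω` for `ω = J`. [cite: GoreskyTai2003RealModuli, §2.2 and §7.2] -/
theorem coe_iStarConj_J :
    ((⟨Matrix.fromBlocks (-1 : Matrix (Fin g) (Fin g) ℝ) 0 0 (1 : Matrix (Fin g) (Fin g) ℝ) *
            ((SymplecticGroup.symJ (Fin g) ℝ : Matrix.symplecticGroup (Fin g) ℝ) :
              Matrix (Fin g ⊕ Fin g) (Fin g ⊕ Fin g) ℝ) *
            Matrix.fromBlocks (-1 : Matrix (Fin g) (Fin g) ℝ) 0 0 (1 : Matrix (Fin g) (Fin g) ℝ),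
          iStar_mul_mul_iStar_mem_symplecticGroup (SymplecticGroup.symJ (Fin g) ℝ).2⟩ :
          Matrix.symplecticGroup (Fin g) ℝ) : Matrix (Fin g ⊕ Fin g) (Fin g ⊕ Fin g) ℝ) = -Matrix.J (Fin g) ℝ :=
  iStar_mul_J_mul_iStar

/-- `ω⁻¹ = −ω` for `ω = J = (0 −I; I 0)` (`ω² = −I`). [cite: GoreskyTai2003RealModuli, §7.2 («set `ω = (0 −I; I 0)`»)] [cite: Lange2023AbelianVarietiesComplex, §3.1.3 (the matrix `J = (0 1; −1 0)` of the alternating form), p. 160] -/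
theorem coe_J_inv :
    (((SymplecticGroup.symJ (Fin g) ℝ : Matrix.symplecticGroup (Fin g) ℝ)⁻¹ :
        Matrix.symplecticGroup (Fin g) ℝ) : Matrix (Fin g ⊕ Fin g) (Fin g ⊕ Fin g) ℝ) = -Matrix.J (Fin g) ℝ := by
  rw [SymplecticGroup.coe_inv]
  change -Matrix.J (Fin g) ℝ * (Matrix.J (Fin g) ℝ)ᵀ * Matrix.J (Fin g) ℝ = -Matrix.J (Fin g) ℝ
  rw [Matrix.J_transpose, neg_mul_neg, Matrix.J_squared, Matrix.neg_mul, Matrix.one_mul]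

/-- **«If the minus sign occurs, set `ω = (0 −I; I 0)`»**: `τ(hω)(hω)⁻¹ = −τ(h)h⁻¹` for every
`h ∈ Sp_{2g}(ℝ)` (`τ(ω)ω⁻¹ = (−ω)(−ω) = ω² = −1` is central). [cite: GoreskyTai2003RealModuli, §7.2] -/
theorem coe_iStarConj_mul_J_mul_inv (h : Matrix.symplecticGroup (Fin g) ℝ) :
    (((⟨Matrix.fromBlocks (-1 : Matrix (Fin g) (Fin g) ℝ) 0 0 (1 : Matrix (Fin g) (Fin g) ℝ) *
            ((h * SymplecticGroup.symJ (Fin g) ℝ : Matrix.symplecticGroup (Fin g) ℝ) :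
              Matrix (Fin g ⊕ Fin g) (Fin g ⊕ Fin g) ℝ) *
            Matrix.fromBlocks (-1 : Matrix (Fin g) (Fin g) ℝ) 0 0 (1 : Matrix (Fin g) (Fin g) ℝ),
          iStar_mul_mul_iStar_mem_symplecticGroup
            (h * SymplecticGroup.symJ (Fin g) ℝ : Matrix.symplecticGroup (Fin g) ℝ).2⟩ :
          Matrix.symplecticGroup (Fin g) ℝ) *
        (h * SymplecticGroup.symJ (Fin g) ℝ)⁻¹ : Matrix.symplecticGroup (Fin g) ℝ) :
        Matrix (Fin g ⊕ Fin g) (Fin g ⊕ Fin g) ℝ) =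
      -(((⟨Matrix.fromBlocks (-1 : Matrix (Fin g) (Fin g) ℝ) 0 0 (1 : Matrix (Fin g) (Fin g) ℝ) *
            (h : Matrix (Fin g ⊕ Fin g) (Fin g ⊕ Fin g) ℝ) *
            Matrix.fromBlocks (-1 : Matrix (Fin g) (Fin g) ℝ) 0 0 (1 : Matrix (Fin g) (Fin g) ℝ),
          iStar_mul_mul_iStar_mem_symplecticGroup h.2⟩ : Matrix.symplecticGroup (Fin g) ℝ) * h⁻¹ :
          Matrix.symplecticGroup (Fin g) ℝ) : Matrix (Fin g ⊕ Fin g) (Fin g ⊕ Fin g) ℝ) := by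
  rw [iStarConj_mul, _root_.mul_inv_rev, Submonoid.coe_mul, Submonoid.coe_mul, Submonoid.coe_mul, Submonoid.coe_mul,
    coe_iStarConj_J, coe_J_inv]
  simp only [Matrix.mul_neg, Matrix.neg_mul, neg_neg, Matrix.mul_assoc]
  rw [← Matrix.mul_assoc (Matrix.J (Fin g) ℝ), Matrix.J_squared, Matrix.neg_mul, Matrix.one_mul]
  simp only [Matrix.mul_neg]

/-- **`ι(KηK) = τ(ι(η))`**: the bridge `ι : Sp_{2g}(ℤ) → Sp_{2g}(ℝ)` intertwines `τ`. [cite: GoreskyTai2003RealModuli, §2.2] -/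
theorem symplecticIntHom_conjK (η : Matrix.symplecticGroup (Fin g) ℤ) :
    symplecticIntHom g ⟨Matrix.fromBlocks (-1 : Matrix (Fin g) (Fin g) ℤ) 0 0 (1 : Matrix (Fin g) (Fin g) ℤ) *
          (η : Matrix (Fin g ⊕ Fin g) (Fin g ⊕ Fin g) ℤ) *
          Matrix.fromBlocks (-1 : Matrix (Fin g) (Fin g) ℤ) 0 0 (1 : Matrix (Fin g) (Fin g) ℤ),
        iStar_mul_mul_iStar_mem_symplecticGroup η.2⟩ =
      ⟨Matrix.fromBlocks (-1 : Matrix (Fin g) (Fin g) ℝ) 0 0 (1 : Matrix (Fin g) (Fin g) ℝ) *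
          ((symplecticIntHom g η : Matrix.symplecticGroup (Fin g) ℝ) : Matrix (Fin g ⊕ Fin g) (Fin g ⊕ Fin g) ℝ) *
          Matrix.fromBlocks (-1 : Matrix (Fin g) (Fin g) ℝ) 0 0 (1 : Matrix (Fin g) (Fin g) ℝ),
        iStar_mul_mul_iStar_mem_symplecticGroup (symplecticIntHom g η).2⟩ :=
  Subtype.ext (by
    change (Matrix.fromBlocks (-1 : Matrix (Fin g) (Fin g) ℤ) 0 0 (1 : Matrix (Fin g) (Fin g) ℤ) *
          (η : Matrix (Fin g ⊕ Fin g) (Fin g ⊕ Fin g) ℤ) *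
          Matrix.fromBlocks (-1 : Matrix (Fin g) (Fin g) ℤ) 0 0 (1 : Matrix (Fin g) (Fin g) ℤ)).map (Int.castRingHom ℝ) =
      Matrix.fromBlocks (-1 : Matrix (Fin g) (Fin g) ℝ) 0 0 (1 : Matrix (Fin g) (Fin g) ℝ) *
        (η : Matrix (Fin g ⊕ Fin g) (Fin g ⊕ Fin g) ℤ).map (Int.castRingHom ℝ) *
        Matrix.fromBlocks (-1 : Matrix (Fin g) (Fin g) ℝ) 0 0 (1 : Matrix (Fin g) (Fin g) ℝ)
    rw [Matrix.map_mul, Matrix.map_mul, conjK_map_castRingHom_g51e])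

section Stab

variable {Z : Matrix (Fin g) (Fin g) ℂ} (hZ : Z ∈ siegelUpperHalfSpace g)
  (hstab : ∀ P ∈ siegelModularGroup g, P • (⟨Z, hZ⟩ : siegelUpperHalfSpace g) = ⟨Z, hZ⟩ →
    (P : Matrix (Fin g ⊕ Fin g) (Fin g ⊕ Fin g) ℝ) = 1 ∨ (P : Matrix (Fin g ⊕ Fin g) (Fin g ⊕ Fin g) ℝ) = -1)

include hstab in
/-- **«By our assumption on `Z`, this implies that `γ = ±…`»**: if `Stab_{Γ_g}(Z) ⊆ {±1}`, two elements of
`Γ_g` carrying `Z` to `τZ` agree up to sign. [cite: GoreskyTai2003RealModuli, §7.2] -/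
theorem coe_eq_or_eq_neg_of_smul_eq_negConj_of_stab {x y : Matrix.symplecticGroup (Fin g) ℝ}
    (hx : x ∈ siegelModularGroup g) (hy : y ∈ siegelModularGroup g)
    (hxZ : x • (⟨Z, hZ⟩ : siegelUpperHalfSpace g) = ⟨-Z.map conj, neg_map_conj_mem_siegelUpperHalfSpace hZ⟩)
    (hyZ : y • (⟨Z, hZ⟩ : siegelUpperHalfSpace g) = ⟨-Z.map conj, neg_map_conj_mem_siegelUpperHalfSpace hZ⟩) :
    (x : Matrix (Fin g ⊕ Fin g) (Fin g ⊕ Fin g) ℝ) = y ∨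
      (x : Matrix (Fin g ⊕ Fin g) (Fin g ⊕ Fin g) ℝ) = -(y : Matrix (Fin g ⊕ Fin g) (Fin g ⊕ Fin g) ℝ) := by
  have hfix : (y⁻¹ * x) • (⟨Z, hZ⟩ : siegelUpperHalfSpace g) = ⟨Z, hZ⟩ := by
    rw [mul_smul, hxZ, ← hyZ, inv_smul_smul]
  have hmem : y⁻¹ * x ∈ siegelModularGroup g := (siegelModularGroup g).mul_mem ((siegelModularGroup g).inv_mem hy) hx
  have hyinv' : (y : Matrix (Fin g ⊕ Fin g) (Fin g ⊕ Fin g) ℝ) *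
      ((y⁻¹ : Matrix.symplecticGroup (Fin g) ℝ) : Matrix (Fin g ⊕ Fin g) (Fin g ⊕ Fin g) ℝ) = 1 := by
    rw [← Submonoid.coe_mul, mul_inv_cancel]; rfl
  rcases hstab _ hmem hfix with h | h
  · left
    have := congrArg ((y : Matrix (Fin g ⊕ Fin g) (Fin g ⊕ Fin g) ℝ) * ·) h
    rwa [Submonoid.coe_mul, ← Matrix.mul_assoc, hyinv', Matrix.one_mul, Matrix.mul_one] at this
  · right
    have := congrArg ((y : Matrix (Fin g ⊕ Fin g) (Fin g ⊕ Fin g) ℝ) * ·) h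
    rwa [Submonoid.coe_mul, ← Matrix.mul_assoc, hyinv', Matrix.one_mul, Matrix.mul_neg, Matrix.mul_one] at this

end Stab

/-! ## §2 «We claim, in this case, that `X` is integral»: at level `2` the matrix `N = 2 Re(y • Z)` is even -/

section Integral

variable (hδ : ∀ i, 0 < (1 : Fin g → ℕ) i) {Z : Matrix (Fin g) (Fin g) ℂ} (hZ : Z ∈ siegelUpperHalfSpace g)
  (hg : 0 < g)
  (hstab : ∀ P ∈ siegelModularGroup g, P • (⟨Z, hZ⟩ : siegelUpperHalfSpace g) = ⟨Z, hZ⟩ →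
    (P : Matrix (Fin g ⊕ Fin g) (Fin g ⊕ Fin g) ℝ) = 1 ∨ (P : Matrix (Fin g ⊕ Fin g) (Fin g ⊕ Fin g) ℝ) = -1)
  {γ : Matrix.symplecticGroup (Fin g) ℤ} (hγ : γ ∈ siegelPrincipalGamma g 2)
  (hsmul : symplecticIntHom g γ • (⟨Z, hZ⟩ : siegelUpperHalfSpace g) =
    ⟨-Z.map conj, neg_map_conj_mem_siegelUpperHalfSpace hZ⟩)

include hstab hγ hsmul in
/-- **«So `2X` is "even"»** — the heart of §7.2.  Let `Stab_{Γ_g}(Z) ⊆ {±1}`, `γ ∈ Γ_g(2)` with `γ • Z = τZ`,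
and let `y ∈ Γ_g`, `N ∈ M_g(ℤ)` with `2 Re(y • Z) = N`.  Then every entry of `N` is even: the translation
`T_N` carries `y • Z` to `τ(y • Z)`, so `x' = τ(y)⁻¹ T_N y` carries `Z` to `τZ`, hence `γ = ±x'`, i.e.
`±T_N = τ(y)γy⁻¹ = (η̃η⁻¹)(ηγη⁻¹)` (`y = ι(η)`) lies in `±Γ(2)` by Lemma 9 (1) and normality of `Γ(2)`; the
off-diagonal block `−N` of `T_N` is therefore `≡ 0 (mod 2)`. [cite: GoreskyTai2003RealModuli, §7.2 and §4 Lemma 9 (1)] -/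
theorem two_dvd_of_two_mul_re_smul_eq_of_mem_siegelPrincipalGamma_two
    {y : Matrix.symplecticGroup (Fin g) ℝ} (hy : y ∈ siegelModularGroup g) {N : Matrix (Fin g) (Fin g) ℤ}
    (hN : ∀ i j, 2 * (((y • (⟨Z, hZ⟩ : siegelUpperHalfSpace g) : siegelUpperHalfSpace g) :
      Matrix (Fin g) (Fin g) ℂ) i j).re = (N i j : ℝ)) (i j : Fin g) :
    (2 : ℤ) ∣ N i j := by
  have hNt : Nᵀ = N := transpose_eq_of_two_mul_re_eq (y • (⟨Z, hZ⟩ : siegelUpperHalfSpace g)).2 hN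
  -- `T_N` carries `y • Z` to its conjugate
  have hT : symplecticIntHom g ⟨Matrix.fromBlocks (1 : Matrix (Fin g) (Fin g) ℤ) (-N) 0 (1 : Matrix (Fin g) (Fin g) ℤ),
        transBlock_mem_symplecticGroup hNt⟩ • (y • (⟨Z, hZ⟩ : siegelUpperHalfSpace g)) =
      ⟨-((y • (⟨Z, hZ⟩ : siegelUpperHalfSpace g) : siegelUpperHalfSpace g) : Matrix (Fin g) (Fin g) ℂ).map conj,
        neg_map_conj_mem_siegelUpperHalfSpace (y • (⟨Z, hZ⟩ : siegelUpperHalfSpace g)).2⟩ :=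
    symplecticIntHom_transBlock_smul_eq_negConj (y • (⟨Z, hZ⟩ : siegelUpperHalfSpace g)).2 hN
  obtain ⟨η, rfl⟩ := MonoidHom.mem_range.1 hy
  -- `x' = τ(y)⁻¹ T_N y` carries `Z` to `τZ`
  set T : Matrix.symplecticGroup (Fin g) ℤ := ⟨Matrix.fromBlocks (1 : Matrix (Fin g) (Fin g) ℤ) (-N) 0
    (1 : Matrix (Fin g) (Fin g) ℤ), transBlock_mem_symplecticGroup hNt⟩ with hTdef
  set τy : Matrix.symplecticGroup (Fin g) ℝ := ⟨Matrix.fromBlocks (-1 : Matrix (Fin g) (Fin g) ℝ) 0 0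
      (1 : Matrix (Fin g) (Fin g) ℝ) * ((symplecticIntHom g η : Matrix.symplecticGroup (Fin g) ℝ) :
        Matrix (Fin g ⊕ Fin g) (Fin g ⊕ Fin g) ℝ) *
      Matrix.fromBlocks (-1 : Matrix (Fin g) (Fin g) ℝ) 0 0 (1 : Matrix (Fin g) (Fin g) ℝ),
    iStar_mul_mul_iStar_mem_symplecticGroup (symplecticIntHom g η).2⟩ with hτydef
  have hx' : (τy⁻¹ * symplecticIntHom g T * symplecticIntHom g η) • (⟨Z, hZ⟩ : siegelUpperHalfSpace g) =
      ⟨-Z.map conj, neg_map_conj_mem_siegelUpperHalfSpace hZ⟩ := by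
    rw [mul_smul, mul_smul, hT, inv_smul_eq_iff, hτydef]
    exact (iStar_smul_negConj (symplecticIntHom g η) ⟨Z, hZ⟩).symm
  have hx'mem : τy⁻¹ * symplecticIntHom g T * symplecticIntHom g η ∈ siegelModularGroup g :=
    (siegelModularGroup g).mul_mem ((siegelModularGroup g).mul_mem
      ((siegelModularGroup g).inv_mem (iStar_mul_mul_iStar_mem_siegelModularGroup ⟨η, rfl⟩)) ⟨T, rfl⟩) ⟨η, rfl⟩
  -- the integral element `P = (KηK) γ η⁻¹ ∈ Γ(2)` with `ι(P) = τ(y) γ y⁻¹`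
  set P : Matrix.symplecticGroup (Fin g) ℤ :=
    ⟨Matrix.fromBlocks (-1 : Matrix (Fin g) (Fin g) ℤ) 0 0 (1 : Matrix (Fin g) (Fin g) ℤ) *
        (η : Matrix (Fin g ⊕ Fin g) (Fin g ⊕ Fin g) ℤ) *
        Matrix.fromBlocks (-1 : Matrix (Fin g) (Fin g) ℤ) 0 0 (1 : Matrix (Fin g) (Fin g) ℤ),
      iStar_mul_mul_iStar_mem_symplecticGroup η.2⟩ * γ * η⁻¹ with hPdef
  have hη1 : η ∈ siegelPrincipalGamma g 1 := by
    rw [siegelPrincipalGamma_one]; exact Subgroup.mem_top η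
  have hP2 : P ∈ siegelPrincipalGamma g 2 := by
    have hsplit : P = (⟨Matrix.fromBlocks (-1 : Matrix (Fin g) (Fin g) ℤ) 0 0 (1 : Matrix (Fin g) (Fin g) ℤ) *
          (η : Matrix (Fin g ⊕ Fin g) (Fin g ⊕ Fin g) ℤ) *
          Matrix.fromBlocks (-1 : Matrix (Fin g) (Fin g) ℤ) 0 0 (1 : Matrix (Fin g) (Fin g) ℤ),
        iStar_mul_mul_iStar_mem_symplecticGroup η.2⟩ * η⁻¹) * (η * γ * η⁻¹) := by
      rw [hPdef]; group
    rw [hsplit]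
    refine (siegelPrincipalGamma g 2).mul_mem ?_ (normal_siegelPrincipalGamma.conj_mem γ hγ η)
    simpa using conjK_mul_inv_mem_siegelPrincipalGamma (m := 1) hη1
  have hιP : symplecticIntHom g P = τy * symplecticIntHom g γ * (symplecticIntHom g η)⁻¹ := by
    rw [hPdef, map_mul, map_mul, map_inv, symplecticIntHom_conjK, hτydef]
  -- `ι(T) = τy x' y⁻¹`, and `x' = ±ι(γ)`
  have hιT : symplecticIntHom g T = τy * (τy⁻¹ * symplecticIntHom g T * symplecticIntHom g η) *
      (symplecticIntHom g η)⁻¹ := by group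
  have hcases : (T : Matrix (Fin g ⊕ Fin g) (Fin g ⊕ Fin g) ℤ) = P ∨
      (T : Matrix (Fin g ⊕ Fin g) (Fin g ⊕ Fin g) ℤ) = -(P : Matrix (Fin g ⊕ Fin g) (Fin g ⊕ Fin g) ℤ) := by
    rcases coe_eq_or_eq_neg_of_smul_eq_negConj_of_stab hZ hstab ⟨γ, rfl⟩ hx'mem hsmul hx' with h | h
    · left
      apply Matrix.map_injective (Int.castRingHom ℝ).injective_int
      change ((symplecticIntHom g T : Matrix.symplecticGroup (Fin g) ℝ) : Matrix (Fin g ⊕ Fin g) (Fin g ⊕ Fin g) ℝ) =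
        ((symplecticIntHom g P : Matrix.symplecticGroup (Fin g) ℝ) : Matrix (Fin g ⊕ Fin g) (Fin g ⊕ Fin g) ℝ)
      rw [hιP, hιT, Submonoid.coe_mul, Submonoid.coe_mul, ← h, Submonoid.coe_mul, Submonoid.coe_mul]
    · right
      apply Matrix.map_injective (Int.castRingHom ℝ).injective_int
      change ((symplecticIntHom g T : Matrix.symplecticGroup (Fin g) ℝ) : Matrix (Fin g ⊕ Fin g) (Fin g ⊕ Fin g) ℝ) =
        (-(P : Matrix (Fin g ⊕ Fin g) (Fin g ⊕ Fin g) ℤ)).map (Int.castRingHom ℝ)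
      rw [Matrix.map_neg _ (map_neg (Int.castRingHom ℝ))]
      change _ = -((symplecticIntHom g P : Matrix.symplecticGroup (Fin g) ℝ) : Matrix (Fin g ⊕ Fin g) (Fin g ⊕ Fin g) ℝ)
      have h' : ((τy⁻¹ * symplecticIntHom g T * symplecticIntHom g η : Matrix.symplecticGroup (Fin g) ℝ) :
          Matrix (Fin g ⊕ Fin g) (Fin g ⊕ Fin g) ℝ) =
          -((symplecticIntHom g γ : Matrix.symplecticGroup (Fin g) ℝ) : Matrix (Fin g ⊕ Fin g) (Fin g ⊕ Fin g) ℝ) := by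
        rw [h, neg_neg]
      rw [hιP, hιT, Submonoid.coe_mul, Submonoid.coe_mul, h', Submonoid.coe_mul, Submonoid.coe_mul, Matrix.mul_neg,
        Matrix.neg_mul]
  -- read off the off-diagonal block modulo `2`
  have hPd : (2 : ℤ) ∣ ((P : Matrix (Fin g ⊕ Fin g) (Fin g ⊕ Fin g) ℤ) - 1) (Sum.inl i) (Sum.inr j) := by
    exact_mod_cast (mem_siegelPrincipalGamma_iff_dvd.1 hP2) (Sum.inl i) (Sum.inr j)
  rw [Matrix.sub_apply, Matrix.one_apply_ne Sum.inl_ne_inr, sub_zero] at hPd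
  have hTij : (T : Matrix (Fin g ⊕ Fin g) (Fin g ⊕ Fin g) ℤ) (Sum.inl i) (Sum.inr j) = -N i j := by
    rw [hTdef]
    change (Matrix.fromBlocks (1 : Matrix (Fin g) (Fin g) ℤ) (-N) 0 (1 : Matrix (Fin g) (Fin g) ℤ)) (Sum.inl i) (Sum.inr j) = _
    rw [Matrix.fromBlocks_apply₁₂, Matrix.neg_apply]
  rcases hcases with h | h
  · rw [← dvd_neg, ← hTij, h]; exact hPd
  · have : N i j = (P : Matrix (Fin g ⊕ Fin g) (Fin g ⊕ Fin g) ℤ) (Sum.inl i) (Sum.inr j) := by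
      have e := congrFun (congrFun h (Sum.inl i)) (Sum.inr j)
      rw [hTij, Matrix.neg_apply, neg_inj] at e
      exact e
    rw [this]; exact hPd

include hδ hstab hγ hsmul hg in
/-- **«`X` is integral»: a `Γ_g(2)`-real point with `Stab_{Γ_g}(Z) ⊆ {±1}` is `Γ_g`-equivalent to a purely
imaginary point** — `Z ∈ Γ_g · iC_g` (Comessatti gives `y • Z = X + iY` with `2X = N` integral, g51-#2 and
g51-#4; `N` is even by the previous theorem, and the translation `T_{N/2} ∈ Γ_g` removes `X`).
[cite: GoreskyTai2003RealModuli, §7.2 («We claim, in this case, that `X` is integral») and §4 Prop. 10] -/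
theorem exists_smul_map_re_eq_zero_of_mem_siegelPrincipalGamma_two :
    ∃ y ∈ siegelModularGroup g,
      ((y • (⟨Z, hZ⟩ : siegelUpperHalfSpace g) : siegelUpperHalfSpace g) : Matrix (Fin g) (Fin g) ℂ).map Complex.re = 0 := by
  obtain ⟨y, hy, N, hNt, hN⟩ := exists_smul_two_mul_re_of_cocycle hδ hZ ⟨γ, rfl⟩ hsmul
    (Subtype.ext (iStar_mul_self_eq_one_of_mem_siegelPrincipalGamma_two hZ hg hstab hγ hsmul))
  have hdvd : ∀ i j, (2 : ℤ) ∣ N i j := fun i j ↦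
    two_dvd_of_two_mul_re_smul_eq_of_mem_siegelPrincipalGamma_two hZ hstab hγ hsmul hy hN i j
  -- `N = 2X'` with `X'` integral symmetric
  set X' : Matrix (Fin g) (Fin g) ℤ := Matrix.of fun i j ↦ N i j / 2 with hX'def
  have hNX : ∀ i j, N i j = 2 * X' i j := fun i j ↦ by
    rw [hX'def, Matrix.of_apply, Int.mul_ediv_cancel' (hdvd i j)]
  have hX't : X'ᵀ = X' := Matrix.ext fun i j ↦ by
    have e : N j i = N i j := by
      have := congrFun (congrFun hNt i) j
      rwa [Matrix.transpose_apply] at this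
    simp only [Matrix.transpose_apply, hX'def, Matrix.of_apply, e]
  refine ⟨symplecticIntHom g ⟨Matrix.fromBlocks (1 : Matrix (Fin g) (Fin g) ℤ) (-X') 0 (1 : Matrix (Fin g) (Fin g) ℤ),
      transBlock_mem_symplecticGroup hX't⟩ * y,
    (siegelModularGroup g).mul_mem (symplecticIntHom_transBlock_mem_siegelModularGroup hX't) hy, ?_⟩
  rw [mul_smul, coe_symplecticIntHom_transBlock_smul hX't]
  ext i j
  rw [Matrix.map_apply, Matrix.sub_apply, Matrix.map_apply, Complex.sub_re, Matrix.zero_apply]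
  have h2 := hN i j
  rw [hNX i j] at h2
  push_cast at h2
  simp only [eq_intCast, Complex.intCast_re]
  linarith

end Integral

/-! ## §3 PROPOSITION 10: `γ = τ(h)h⁻¹` with `h ∈ Γ_g`, and `𝔥_g^γ = h · iC_g` -/

section Coboundary

variable (hδ : ∀ i, 0 < (1 : Fin g → ℕ) i) {Z : Matrix (Fin g) (Fin g) ℂ} (hZ : Z ∈ siegelUpperHalfSpace g)
  (hg : 0 < g)

include hδ hg in
/-- **PROPOSITION 10 (Goresky–Tai).**  Let `Z ∈ 𝔥_g` (`g ≥ 1`) be fixed by no element of `Γ_g = Sp_{2g}(ℤ)`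
other than `±I`, let `γ ∈ Γ_g(2)` with `γ • Z = τZ = −Z̄`.  Then `γ` is a coboundary: `γ = τ(h)h⁻¹` for some
`h ∈ Γ_g`, and consequently `𝔥_g^γ = h · iC_g` (`γ • Ω = τΩ ⟺ h⁻¹ • Ω` purely imaginary).  Proof as printed:
`Z = y⁻¹ • iY` (§2), `c = τ(y⁻¹)(y⁻¹)⁻¹` carries `Z` to `τZ`, so `γ = ±c`; `+`: `h = y⁻¹`; `−`: `h = y⁻¹ω`.
[cite: GoreskyTai2003RealModuli, §4 Prop. 10 and §7.2 (7.3); §3.3 Lemma 3, Prop. 6] -/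
theorem exists_coboundary_of_mem_siegelPrincipalGamma_two
    (hstab : ∀ P ∈ siegelModularGroup g, P • (⟨Z, hZ⟩ : siegelUpperHalfSpace g) = ⟨Z, hZ⟩ →
      (P : Matrix (Fin g ⊕ Fin g) (Fin g ⊕ Fin g) ℝ) = 1 ∨ (P : Matrix (Fin g ⊕ Fin g) (Fin g ⊕ Fin g) ℝ) = -1)
    {γ : Matrix.symplecticGroup (Fin g) ℤ} (hγ : γ ∈ siegelPrincipalGamma g 2)
    (hsmul : symplecticIntHom g γ • (⟨Z, hZ⟩ : siegelUpperHalfSpace g) =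
      ⟨-Z.map conj, neg_map_conj_mem_siegelUpperHalfSpace hZ⟩) :
    ∃ h ∈ siegelModularGroup g,
      symplecticIntHom g γ =
          (⟨Matrix.fromBlocks (-1 : Matrix (Fin g) (Fin g) ℝ) 0 0 (1 : Matrix (Fin g) (Fin g) ℝ) *
                (h : Matrix (Fin g ⊕ Fin g) (Fin g ⊕ Fin g) ℝ) *
                Matrix.fromBlocks (-1 : Matrix (Fin g) (Fin g) ℝ) 0 0 (1 : Matrix (Fin g) (Fin g) ℝ),
              iStar_mul_mul_iStar_mem_symplecticGroup h.2⟩ : Matrix.symplecticGroup (Fin g) ℝ) * h⁻¹ ∧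
        ∀ Ω : siegelUpperHalfSpace g,
          symplecticIntHom g γ • Ω = ⟨-(Ω : Matrix (Fin g) (Fin g) ℂ).map conj, neg_map_conj_mem_siegelUpperHalfSpace Ω.2⟩ ↔
            ((h⁻¹ • Ω : siegelUpperHalfSpace g) : Matrix (Fin g) (Fin g) ℂ).map Complex.re = 0 := by
  obtain ⟨y, hy, hre⟩ := exists_smul_map_re_eq_zero_of_mem_siegelPrincipalGamma_two hδ hZ hg hstab hγ hsmul
  -- `W = y • Z` is `τ`-fixed, so the coboundary `c = τ(y⁻¹) y` carries `Z` to `τZ`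
  have hW : (⟨-((y • (⟨Z, hZ⟩ : siegelUpperHalfSpace g) : siegelUpperHalfSpace g) : Matrix (Fin g) (Fin g) ℂ).map conj,
      neg_map_conj_mem_siegelUpperHalfSpace (y • (⟨Z, hZ⟩ : siegelUpperHalfSpace g)).2⟩ : siegelUpperHalfSpace g) =
      y • (⟨Z, hZ⟩ : siegelUpperHalfSpace g) :=
    Subtype.ext ((neg_map_conj_eq_self_iff _).2 hre)
  have hc := coboundary_smul_smul_eq_negConj y⁻¹ (y • (⟨Z, hZ⟩ : siegelUpperHalfSpace g)) hW
  rw [inv_smul_smul] at hc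
  have hcmem : (⟨Matrix.fromBlocks (-1 : Matrix (Fin g) (Fin g) ℝ) 0 0 (1 : Matrix (Fin g) (Fin g) ℝ) *
        ((y⁻¹ : Matrix.symplecticGroup (Fin g) ℝ) : Matrix (Fin g ⊕ Fin g) (Fin g ⊕ Fin g) ℝ) *
        Matrix.fromBlocks (-1 : Matrix (Fin g) (Fin g) ℝ) 0 0 (1 : Matrix (Fin g) (Fin g) ℝ),
      iStar_mul_mul_iStar_mem_symplecticGroup (y⁻¹).2⟩ : Matrix.symplecticGroup (Fin g) ℝ) * (y⁻¹)⁻¹ ∈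
      siegelModularGroup g :=
    (siegelModularGroup g).mul_mem (iStar_mul_mul_iStar_mem_siegelModularGroup ((siegelModularGroup g).inv_mem hy))
      ((siegelModularGroup g).inv_mem ((siegelModularGroup g).inv_mem hy))
  have key : ∀ h : Matrix.symplecticGroup (Fin g) ℝ,
      symplecticIntHom g γ =
          (⟨Matrix.fromBlocks (-1 : Matrix (Fin g) (Fin g) ℝ) 0 0 (1 : Matrix (Fin g) (Fin g) ℝ) *
                (h : Matrix (Fin g ⊕ Fin g) (Fin g ⊕ Fin g) ℝ) *
                Matrix.fromBlocks (-1 : Matrix (Fin g) (Fin g) ℝ) 0 0 (1 : Matrix (Fin g) (Fin g) ℝ),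
              iStar_mul_mul_iStar_mem_symplecticGroup h.2⟩ : Matrix.symplecticGroup (Fin g) ℝ) * h⁻¹ →
        ∀ Ω : siegelUpperHalfSpace g,
          symplecticIntHom g γ • Ω = ⟨-(Ω : Matrix (Fin g) (Fin g) ℂ).map conj, neg_map_conj_mem_siegelUpperHalfSpace Ω.2⟩ ↔
            ((h⁻¹ • Ω : siegelUpperHalfSpace g) : Matrix (Fin g) (Fin g) ℂ).map Complex.re = 0 := by
    intro h hγh Ω
    rw [hγh]
    exact smul_eq_negConj_iff_of_coboundary h Ω
  rcases coe_eq_or_eq_neg_of_smul_eq_negConj_of_stab hZ hstab ⟨γ, rfl⟩ hcmem hsmul hc with h | h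
  · -- the plus sign: `h = y⁻¹`
    exact ⟨y⁻¹, (siegelModularGroup g).inv_mem hy, Subtype.ext h, key _ (Subtype.ext h)⟩
  · -- the minus sign: `h = y⁻¹ω`
    have hγh : symplecticIntHom g γ =
        (⟨Matrix.fromBlocks (-1 : Matrix (Fin g) (Fin g) ℝ) 0 0 (1 : Matrix (Fin g) (Fin g) ℝ) *
              ((y⁻¹ * SymplecticGroup.symJ (Fin g) ℝ : Matrix.symplecticGroup (Fin g) ℝ) :
                Matrix (Fin g ⊕ Fin g) (Fin g ⊕ Fin g) ℝ) *
              Matrix.fromBlocks (-1 : Matrix (Fin g) (Fin g) ℝ) 0 0 (1 : Matrix (Fin g) (Fin g) ℝ),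
            iStar_mul_mul_iStar_mem_symplecticGroup
              (y⁻¹ * SymplecticGroup.symJ (Fin g) ℝ : Matrix.symplecticGroup (Fin g) ℝ).2⟩ :
            Matrix.symplecticGroup (Fin g) ℝ) *
          (y⁻¹ * SymplecticGroup.symJ (Fin g) ℝ)⁻¹ :=
      Subtype.ext (h.trans (coe_iStarConj_mul_J_mul_inv y⁻¹).symm)
    exact ⟨y⁻¹ * SymplecticGroup.symJ (Fin g) ℝ,
      (siegelModularGroup g).mul_mem ((siegelModularGroup g).inv_mem hy) J_mem_siegelModularGroup, hγh, key _ hγh⟩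

variable (hEnd : ∀ M : Matrix (Fin g ⊕ Fin g) (Fin g ⊕ Fin g) ℤ,
    (∀ x, (M.map (Int.cast : ℤ → ℝ)) *ᵥ latticeJ (siegelPeriodEquiv hδ hZ) x =
      latticeJ (siegelPeriodEquiv hδ hZ) ((M.map (Int.cast : ℤ → ℝ)) *ᵥ x)) → ∃ c : ℤ, M = c • 1)

include hEnd hg in
/-- **Proposition 10 at `End(X_Z) = ℤ` points** (the isotropy hypothesis from g51-#3
`smul_eq_self_iff_of_end_eq_smul_one_of_mem_siegelModularGroup`): `γ ∈ Γ_g(2)`, `γ • Z = τZ` ⟹ `Z` is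
`Γ_g`-equivalent to a purely imaginary point, `γ = τ(h)h⁻¹` with `h ∈ Γ_g`, and `𝔥_g^γ = h · iC_g`.
[cite: GoreskyTai2003RealModuli, §4 Prop. 10 and §7.2] [cite: Shimura1972FieldOfRationality, §3 Prop. 12 (hypothesis), p. 176] -/
theorem exists_coboundary_of_mem_siegelPrincipalGamma_two_of_end_eq_smul_one
    {γ : Matrix.symplecticGroup (Fin g) ℤ} (hγ : γ ∈ siegelPrincipalGamma g 2)
    (hsmul : symplecticIntHom g γ • (⟨Z, hZ⟩ : siegelUpperHalfSpace g) =
      ⟨-Z.map conj, neg_map_conj_mem_siegelUpperHalfSpace hZ⟩) :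
    (∃ y ∈ siegelModularGroup g,
        ((y • (⟨Z, hZ⟩ : siegelUpperHalfSpace g) : siegelUpperHalfSpace g) : Matrix (Fin g) (Fin g) ℂ).map
          Complex.re = 0) ∧
      ∃ h ∈ siegelModularGroup g,
        symplecticIntHom g γ =
            (⟨Matrix.fromBlocks (-1 : Matrix (Fin g) (Fin g) ℝ) 0 0 (1 : Matrix (Fin g) (Fin g) ℝ) *
                  (h : Matrix (Fin g ⊕ Fin g) (Fin g ⊕ Fin g) ℝ) *
                  Matrix.fromBlocks (-1 : Matrix (Fin g) (Fin g) ℝ) 0 0 (1 : Matrix (Fin g) (Fin g) ℝ),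
                iStar_mul_mul_iStar_mem_symplecticGroup h.2⟩ : Matrix.symplecticGroup (Fin g) ℝ) * h⁻¹ ∧
          ∀ Ω : siegelUpperHalfSpace g,
            symplecticIntHom g γ • Ω = ⟨-(Ω : Matrix (Fin g) (Fin g) ℂ).map conj, neg_map_conj_mem_siegelUpperHalfSpace Ω.2⟩ ↔
              ((h⁻¹ • Ω : siegelUpperHalfSpace g) : Matrix (Fin g) (Fin g) ℂ).map Complex.re = 0 :=
  have hstab : ∀ P ∈ siegelModularGroup g, P • (⟨Z, hZ⟩ : siegelUpperHalfSpace g) = ⟨Z, hZ⟩ →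
      (P : Matrix (Fin g ⊕ Fin g) (Fin g ⊕ Fin g) ℝ) = 1 ∨ (P : Matrix (Fin g ⊕ Fin g) (Fin g ⊕ Fin g) ℝ) = -1 :=
    fun _ hP hPZ ↦ (smul_eq_self_iff_of_end_eq_smul_one_of_mem_siegelModularGroup hδ hZ hEnd hg hP).1 hPZ
  ⟨exists_smul_map_re_eq_zero_of_mem_siegelPrincipalGamma_two hδ hZ hg hstab hγ hsmul,
    exists_coboundary_of_mem_siegelPrincipalGamma_two hδ hZ hg hstab hγ hsmul⟩

include hδ hg in
/-- **Proposition 10 at Hodge-general points** (`Z ∉ 𝒩_Hg`, the tree's «generic»): `γ ∈ Γ_g(2)`,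
`γ • Z = τZ` ⟹ `Z ∈ Γ_g · iC_g`, `γ = τ(h)h⁻¹` with `h ∈ Γ_g`, and `𝔥_g^γ = h · iC_g`.
[cite: GoreskyTai2003RealModuli, §4 Prop. 10 and §7.2] [cite: Lange2023AbelianVarietiesComplex, §7.3.1 Prop. 7.3.2 and §3.1.2 Cor. 3.1.5] -/
theorem exists_coboundary_of_mem_siegelPrincipalGamma_two_of_hodgeGeneral
    (hgen : (⟨Z, hZ⟩ : siegelUpperHalfSpace g) ∉ hodgeGroupExceptionalLocus g)
    {γ : Matrix.symplecticGroup (Fin g) ℤ} (hγ : γ ∈ siegelPrincipalGamma g 2)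
    (hsmul : symplecticIntHom g γ • (⟨Z, hZ⟩ : siegelUpperHalfSpace g) =
      ⟨-Z.map conj, neg_map_conj_mem_siegelUpperHalfSpace hZ⟩) :
    (∃ y ∈ siegelModularGroup g,
        ((y • (⟨Z, hZ⟩ : siegelUpperHalfSpace g) : siegelUpperHalfSpace g) : Matrix (Fin g) (Fin g) ℂ).map
          Complex.re = 0) ∧
      ∃ h ∈ siegelModularGroup g,
        symplecticIntHom g γ =
            (⟨Matrix.fromBlocks (-1 : Matrix (Fin g) (Fin g) ℝ) 0 0 (1 : Matrix (Fin g) (Fin g) ℝ) *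
                  (h : Matrix (Fin g ⊕ Fin g) (Fin g ⊕ Fin g) ℝ) *
                  Matrix.fromBlocks (-1 : Matrix (Fin g) (Fin g) ℝ) 0 0 (1 : Matrix (Fin g) (Fin g) ℝ),
                iStar_mul_mul_iStar_mem_symplecticGroup h.2⟩ : Matrix.symplecticGroup (Fin g) ℝ) * h⁻¹ ∧
          ∀ Ω : siegelUpperHalfSpace g,
            symplecticIntHom g γ • Ω = ⟨-(Ω : Matrix (Fin g) (Fin g) ℂ).map conj, neg_map_conj_mem_siegelUpperHalfSpace Ω.2⟩ ↔
              ((h⁻¹ • Ω : siegelUpperHalfSpace g) : Matrix (Fin g) (Fin g) ℂ).map Complex.re = 0 :=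
  exists_coboundary_of_mem_siegelPrincipalGamma_two_of_end_eq_smul_one hδ hZ hg
    (end_eq_smul_one_of_not_mem_hodgeGroupExceptionalLocus hδ hZ hgen) hγ hsmul

end Coboundary

end SiegelModuli

end Literature.AlgebraicGeometry.ModuliOfAbelianVarieties
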